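/- Copyright: the b2b-balaban cell (near-miss cell 7), T⁴-continuum fan-out, lineage t4-ne7b-formalise-leaf-04 (NE7b
CRUX team (2), leaf prover 04) on the row-NE7b OWNER's INTERFACE REQUEST NE7b IR-41-8 «M2 brick B», sanity companion.
Released under the licence of the surrounding project. -/
import Summits.QuantumFields.BalabanUV.T4Continuum.Support.B16HistoryInputFamily
import Summits.QuantumFields.BalabanUV.T4Continuum.Support.B16HistoryIndexedReprSanity

/-!
# Sanity for M2 brick B: the reading data, the factor data and the displayed identification `HistRead` are JOINTLY
INHABITED together with the owner's process binders, and `weight_le_evProd` COMPUTES — and is SHARP — on the trivial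
reading (companion of `B16HistoryInputFamily`; lineage `t4-ne7b-formalise-leaf-04` gen 25, INTERFACE REQUEST NE7b IR-41-8)

Summits-side support leaf of the T⁴-continuum cell (rung (B)+1 on a FINITE torus only; NOT infinite volume, NOT the
mass gap, NOT Clay; NOT a proof of NE7b — the cell's OWN estimate, NOT PRINTED, NOT PROVED).  [folklore] decided toy
arithmetic over M1's sanity skeleton `Sanity.toyI`; nothing printed asserted, no `def … : Prop` fact of Bałaban's, no
cite-tagged hypothesis, zero `sorry`.

THE TOY.  Every cutoff carries M1's sanity skeleton `toyI` (two outer summands, histories `Fin 2`, one sub-history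
choice, two curly summands) with ALL operations the identity (`toy1`: unit weights `1`, `χ ≡ 1`, `A′ ≡ 0`, `V ≡ 0`) on the
one-point configuration space `Unit` with the Dirac reference measure; the reading `ℛ₀` names NO large-field region
(`N ≡ ∅`, `F ≡ ∅`; flow `L = 2`, `s ≡ 0`, `R ≡ 1 ≡ Rm`); the factor data `Φ₀` are `fB ≡ fR ≡ Λ ≡ 1`, envelopes
`wZ ≡ wY ≡ wC ≡ 1`, `BA ≡ BV ≡ 0`.  KERNEL-DECIDED: (S1) a run with no new region has NO component at any level
(`comp_histM_eq_empty_of_N` — for ANY `RunInputM`, a small structural fact about leaf-05's process); (S2) `HistRead ℛ₀ Φ₀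
toy1 1 0` HOLDS (`histRead_toy`) — the envelopes are attained and the identification `forest_le` reads `1 · 1 ≤ 1` (empty
forest); the owner's binders `NewOK` (vacuous) and `Rm ≤ R` hold; (S3) the weight of the term
`⟨0, false, (0, (), 0)⟩` IS `1` (`weight_toy`) and `weight_le_evProd_mk` returns the bound `1` (`weight_le_one_toy`): the
chain M1 → M2-A → part 1 → part 2 computes end to end and is SHARP on the trivial reading.  Content is of course nil —
the content of M2 brick B is in the displayed clauses; this file shows they are jointly consistent and that the kernel
junction is live.

HONEST.  Proves nothing of Bałaban's; BY-NAME EFFECT ON THE WALL: NONE; NE7b NOT proved; spine 0∕9.  HONEST DEPENDENCY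
(cell): continuum YM on T⁴ ⇐ BetaPertH ∧ nine spine estimates (0/9 proved); BetaPertH ⇐ (D1) ∧ (D4) ∧ CAP+tail; G-an2-4
gates asym, D1 and NE2/3/4.  This file changes none of it.
-/

open Finset MeasureTheory
open Literature.MathematicalPhysics.QuantumFieldTheory.Balaban1983to89
open Summit.QuantumFields.BalabanUV.T4Continuum.HistoryAdmissible
open Summit.QuantumFields.BalabanUV.T4Continuum.HistoryGenealogyExtraction
open Summit.QuantumFields.BalabanUV.T4Continuum.HistoryGenealogyRealise
open Summit.QuantumFields.BalabanUV.T4Continuum.HistoryGenealogyInstantiate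
open Summit.QuantumFields.BalabanUV.T4Continuum.HistoryTouchComponents

/-! ## (S1) A run with no new region has no component -/

namespace Summit.QuantumFields.BalabanUV.T4Continuum.HistoryGenealogyInstantiate.RunInputM

variable {d : ℕ} (J : RunInputM d)

/-- with no new region and no previous line, no line is formed [folklore] -/
theorem formM_empty_of_N (hN : ∀ ℓ, J.N ℓ = ∅) (ℓ : ℕ) : J.formM ℓ ∅ = ∅ := by
  simp [RunInputM.formM, RunInputM.blocksM, RunInputM.vertM, tcomps, hN ℓ]

/-- **A RUN WITH NO NEW REGION HAS NO LIVE LINE** at any level. [folklore] -/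
theorem StM_eq_empty_of_N (hN : ∀ ℓ, J.N ℓ = ∅) (ℓ : ℕ) : J.StM ℓ = ∅ := by
  induction ℓ with
  | zero => rw [J.StM_eq_formM]; exact J.formM_empty_of_N hN 0
  | succ ℓ ih =>
      rw [J.StM_eq_formM, show J.PrevM (ℓ + 1) = J.StM ℓ from rfl, ih]
      exact J.formM_empty_of_N hN (ℓ + 1)

/-- … hence NO COMPONENT in its extracted bookkeeping. [folklore] -/
theorem comp_histM_eq_empty_of_N (hN : ∀ ℓ, J.N ℓ = ∅) (ℓ : ℕ) : J.histM.comp ℓ = ∅ := by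
  show (J.StM ℓ).image lab = ∅
  rw [J.StM_eq_empty_of_N hN ℓ, Finset.image_empty]

/-- … and nothing dies. [folklore] -/
theorem died_histM_eq_empty_of_N (hN : ∀ ℓ, J.N ℓ = ∅) (ℓ : ℕ) : J.histM.died ℓ = ∅ := by
  rw [ComponentHistory.died, J.comp_histM_eq_empty_of_N hN ℓ, Finset.empty_sdiff]

end Summit.QuantumFields.BalabanUV.T4Continuum.HistoryGenealogyInstantiate.RunInputM

namespace Summit.QuantumFields.BalabanUV.T4Continuum.B16HistoryIndexedRepr.SanityInput

open RelLinPosOp Repr172R HIndex Sanity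

/-! ## The toy: identity operations on M1's sanity skeleton, the empty reading, unit factors -/

/-- ALL operations the identity over M1's sanity skeleton `toyI` (unit weights). [folklore] -/
noncomputable def toy1 : Repr172R (GoodClass.top Unit) toyI where
  χ _ _ := 1
  A' _ := 0
  TZh _ _ := RelLinPosOp.idR _
  TYl _ _ := RelLinPosOp.idR _
  TC _ _ := RelLinPosOp.idR _
  Vs _ _ _ _ _ := 0
  χ_good _ := trivial
  expA_good := trivial
  E_good _ _ _ _ := trivial
  TZh_allSmall _ := rfl
  TYl_allSmall _ := rfl

/-- the same skeleton at every cutoff [folklore] -/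
@[reducible] def Isk : (K : ℕ) → HIndex ((fun _ : ℕ => ℕ) K) := fun _ => toyI

/-- THE EMPTY READING in dimension `1`: no new region, no new field; flow `L = 2`, `s ≡ 0`, `R ≡ 1 ≡ Rm`. [folklore] -/
def ℛ₀ : HistReading Isk 1 where
  L := 2
  s _ _ := 0
  R _ _ := 1
  Rm _ _ _ := 1
  N _ _ _ _ := ∅
  cls _ _ _ _ := 0
  F _ _ _ _ := ∅

/-- UNIT FACTOR DATA: `fB ≡ fR ≡ 1`, `Λ ≡ 1`, all envelopes `1`, `BA ≡ BV ≡ 0`. [folklore] -/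
def Φ₀ : HistFactors Isk 1 where
  fB _ _ _ _ := 1
  fR _ _ := 1
  Λ _ _ := 1
  one_le_Λ _ _ := le_rfl
  wZ _ _ _ _ := 1
  wY _ _ _ _ := 1
  wC _ _ _ _ := 1
  BA _ _ := 0
  BV _ _ _ _ _ _ := 0

/-- the runs read off the empty reading have no component [folklore] -/
theorem comp_runOf_eq_empty (K : ℕ) (a : (Isk K).Adm) (ι : (Isk K).HZ × (Isk K).HL × (Isk K).HC) (j : ℕ) :
    (ℛ₀.runOf K a ι).histM.comp j = ∅ :=
  (ℛ₀.runOf K a ι).comp_histM_eq_empty_of_N (fun _ => rfl) j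

/-- … and nothing dies in them [folklore] -/
theorem died_runOf_eq_empty (K : ℕ) (a : (Isk K).Adm) (ι : (Isk K).HZ × (Isk K).HL × (Isk K).HC) (j : ℕ) :
    (ℛ₀.runOf K a ι).histM.died j = ∅ :=
  (ℛ₀.runOf K a ι).died_histM_eq_empty_of_N (fun _ => rfl) j

/-! ## (S2) The displayed identification and the owner's binders are jointly inhabited -/

/-- **(S2) `HistRead` HOLDS ON THE TOY** (source radius `1`, threshold `0`): every envelope is attained (`idR` has unit
weight, `χ ≡ 1`, `A′ ≡ 0 ≤ 0`, `V ≡ 0 ≤ 0`) and the identification reads `1 · 1 ≤ 1` — the empty forest. [folklore] -/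
theorem histRead_toy : HistRead ℛ₀ Φ₀ (fun _ _ => toy1) 1 0 where
  χ01 _ _ _ _ := ⟨zero_le_one, le_rfl⟩
  tz_le _ _ _ _ _ _ _ _ := le_of_eq rfl
  ty_le _ _ _ _ _ _ _ _ := le_of_eq rfl
  tc_le _ _ _ _ _ _ _ _ := le_of_eq rfl
  A'_le _ _ _ _ _ := le_rfl
  Vs_le _ _ _ _ _ _ _ _ _ := le_rfl
  forest_le K t _ _ a ι _ := by
    show (1 : ℝ) * 1 ≤ _
    rw [Finset.prod_congr rfl fun j _ => by rw [comp_runOf_eq_empty K a ι j, Finset.prod_empty], Finset.prod_const_one]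
    norm_num

/-- the owner's input binder `NewOK` holds (vacuously: no new region) [folklore] -/
theorem newOK_toy (K : ℕ) (a : (Isk K).Adm) (ι : (Isk K).HZ × (Isk K).HL × (Isk K).HC) : (ℛ₀.runOf K a ι).NewOK :=
  ⟨fun _ _ hn => by simp [HistReading.runOf, ℛ₀] at hn⟩

/-- the owner's memory-domination binder holds (`Rm ≡ R`) [folklore] -/
theorem rm_le_toy (K : ℕ) (a : (Isk K).Adm) (ι : (Isk K).HZ × (Isk K).HL × (Isk K).HC) :
    ∀ t k, (ℛ₀.runOf K a ι).Rm t k ≤ (ℛ₀.runOf K a ι).R t := fun _ _ => le_rfl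

/-! ## (S3) The weight bound computes and is sharp -/

/-- the Dirac reference measure on the one-point configuration space, at every cutoff [folklore] -/
noncomputable def μ₀ : (K : ℕ) → Measure ((fun _ : ℕ => Unit) K) := fun _ => Measure.dirac ()

/-- it is finite [folklore] -/
instance (K : ℕ) : IsFiniteMeasure (μ₀ K) := by unfold μ₀; infer_instance

/-- the elementary term of the all-small summand's choice `(0, (), 0)` is `1` [folklore] -/
theorem eterm_toy (x : Unit) : toy1.eterm false ((0 : Fin 2), (), (0 : Fin 2)) x = 1 := by
  show (1 : ℝ) * (RelLinPosOp.idR (GoodClass.top Unit)).T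
      (fun _ => Real.exp 0 * (RelLinPosOp.idR (GoodClass.top Unit)).T
        ((RelLinPosOp.idR (GoodClass.top Unit)).T (fun _ => Real.exp 0)) x) x = 1
  simp [RelLinPosOp.idR]

/-- **(S3a) THE WEIGHT OF THE TERM `⟨0, false, (0, (), 0)⟩` IS `1`** (Dirac integral of the unit elementary term). [folklore] -/
theorem weight_toy : Repr172R.weight μ₀ (fun _ _ => toy1) 0 (⟨0, false, ((0 : Fin 2), (), (0 : Fin 2))⟩ : HIndex.Idx Isk) = 1 := by
  show ∫ x, toy1.eterm false ((0 : Fin 2), (), (0 : Fin 2)) x ∂(Measure.dirac ()) = 1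
  rw [MeasureTheory.integral_dirac, eterm_toy]

/-- **(S3b) `weight_le_evProd_mk` RETURNS THE BOUND `1`** on that term — empty forest (`exp 0`, empty live and dead
products, empty cost product), `rest = e⁰ · (1 · e⁰) · mass = 1` — so the bound is ATTAINED: the chain M1 → M2-A → part 1 → part 2 computes end
to end and is sharp on the trivial reading. [folklore] -/
theorem weight_le_one_toy :
    Repr172R.weight μ₀ (fun _ _ => toy1) 0 (⟨0, false, ((0 : Fin 2), (), (0 : Fin 2))⟩ : HIndex.Idx Isk) ≤ 1 := by
  have hι : (((0 : Fin 2), (), (0 : Fin 2)) : (Isk 0).HZ × (Isk 0).HL × (Isk 0).HC) ∈ (Isk 0).LIdx false := by decide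
  have h := weight_le_evProd_mk ℛ₀ Φ₀ μ₀ (fun _ _ => toy1) histRead_toy (le_refl 0) (t := 0) (by norm_num) false hι
    (newOK_toy 0 false _) (rm_le_toy 0 false _)
  have hmass : (μ₀ 0).real Set.univ = 1 := by simp [μ₀]
  rw [Finset.prod_congr rfl fun j _ => by rw [comp_runOf_eq_empty 0 false _ j, Finset.prod_empty], Finset.prod_const_one,
    comp_runOf_eq_empty 0 false _ 0, Finset.prod_empty,
    Finset.prod_congr rfl fun j _ => by rw [died_runOf_eq_empty 0 false _ j, Finset.prod_empty],
    Finset.prod_const_one, hmass] at h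
  simpa [Φ₀] using h

end Summit.QuantumFields.BalabanUV.T4Continuum.B16HistoryIndexedRepr.SanityInput
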